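import Summits.ABC.IUTFork.Conditional.AbcOfSGenuineMShrinkDepth
import Summits.ABC.IUTFork.Conditional.AbcOfSGenuineKTameRobust
import Summits.ABC.IUTFork.Cor312LicenceExactOrdersMGenuine
import Summits.ABC.IUTFork.Cor312PilotIdelesMReadOrders
import HarnessLib

/-!
# M LINE twin of the ROBUST tame-exact refutation at rational points: at the summand-route M-level sharp setting of a genuine
# datum's OWN read-off ideles, ONE lattice-tame member of the fibre `V̲_u` over a pole prime `p` of `j(λ)` of order `h` with
# `(j−1)·h ≥ 2l` refutes the hull-level clause S_H — the `e`-FREE test of the K line (abc-iut-w5-d107 p459701/p460144) VERBATIM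

PROOF-ONLY file (no `def`, no new `Prop`, no instance) of the abc-iut cell (seat abc-iut-W-ref-1, gen 3; director-abc g3 MINT-LIST BATCH 1,
ROW «TARGETS.tsv 043f473bc4159fa7 kind TE rows 1–25» — the M column of the TE-exact rows; HOME/STATUS «W:M-TE-ROBUST»). TAKES NO SIDE on
[IUTchIII] Cor. 3.12 (S. Mochizuki, *Inter-universal Teichmüller theory III*, Cor. 3.12 p. 173–174, Step (xi-f) p. 184) or on any author.
NO new engine — three landed pieces composed:
* abc-iut-w5-d166's TAME-MEMBER refutation of the licence at the M-level setting of the datum's own ideles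
  `Thm311.Real.not_licence_settingPrVolSharpM_tOfIdeleData_of_tame_orders` (`Cor312LicenceExactOrdersMGenuine`, p467871: `p_u > 2`,
  `e = e(K_{x₀}/ℚ_p) ≤ p_u − 2`, `‖t_{q,x₀}‖ = ‖ϖ‖^{m_q}`, and `m_q < e·(((i+1)²·m_q − 1)/e) + 1 − (i+1)·(e − 1)` ⟹ ¬ Licence), read through
  the q-pin (`licence_of_pilotKummerCompatHull`, `rfl`) exactly as in abc-iut-w5-d166's `GenuineMShrink2.not_pilotKummerCompatHull_of_explicit_depth`;
* abc-iut-w5-d166's VALUE of the integer order at a bad member with rational `j`-invariant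
  `Thm311.Real.two_mul_l_mul_order_tqM_eq_of_j_eq` (`Cor312PilotIdelesMReadOrders`, p469681: `2l·m_q = −e·ord_p(j₀)`), the member being bad
  by `placeModOfM_mem_S_and_norm_tqM_le_of_ratPoint` (`Cor312PilotIdelesMReadDeep`);
* abc-iut-w5-d107's floor-free integer lemma `TameRobust.lt_decider_of_le` (`AbcOfSGenuineKTameRobust`, p459701: `e ≤ i₀·m_q` fires the test).
Since `2l·m_q = e·H` with `H = −ord_p j(λ) ≥ h` the EXACT pole order, `e ≤ i₀·m_q ⟸ 2l ≤ i₀·h`: the unknown local type `e` CANCELS, and the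
M-line test is the K line's **`(j−1)·h ≥ 2l`** verbatim (there `P_q = e·h/(2l)` for the CHOSEN realising ideles; here `m_q` is READ OFF the datum).

* `GenuineM.not_pilotKummerCompatHull_ratPoint_of_tame_robust` — `λ ∈ ℚ`, `T` a genuine Θ-volume datum at `(ratPoint λ, l)`, a finite place `u`
  of `ℚ` with `p_u ≠ 2, l` at which `j(λ)` has a pole of order `≥ h ≥ 1`, a label `j = i₀+1 ≤ l⋆` with **`2l ≤ i₀·h`**, and ONE member `x₀ ∈ V̲_u`
  with `e(K_{x₀}/ℚ_{p_u}) ≤ p_u − 2` (the LOCAL-TYPE input, a binder — at rational `j` the fibre is a singleton, abc-iut-w5-d166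
  `fibre_eq_of_j_mem_range`) ⇒ the hull-level clause S_H at abc-iut-s2-p8's summand-route M-level sharp setting of `T`'s own read-off ideles
  (pinned reading — VERBATIM the per-datum object of the M-line window binders `hSHw` of `abc_of_SH_v11M_window` p445989 / `…_szpiroBadAll`
  p453767 and of abc-iut-w5-d107's `GenuineM.…_ratPoint_of_linUniform` p466001) FAILS for every choice of the free context binders and Kummer datum;
* `GenuineM.not_pilotKummerCompatHull_ratPoint_of_localType` — the same with the binder in PLACE form: every place `w` of `T.K` of residue
  characteristic `p_u` has `e(w | p_u) ≤ p_u − 2` (the shape the cell's local-type lemmas deliver; `K_{x₀}` IS the rescaled completion of `T.K`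
  at `placeOfM x₀`, `absRamificationIdx_rescaledCompletion`) — the M twin of abc-iut-W-ref-2's `GenuineK.…_ratPoint_of_localType` (p465202).
The sequels `AbcOfSGenuineMTameRobustThirty` (`e ∣ 30·l`, floor `30·l + 2`) and `AbcOfSGenuineMTameRobustTate` (`e ∣ 10·l` / `∣ 6·l`) discharge
the binder exactly as on the K line.

HONEST SCOPE (binding, as in the parents): SHARP reading (Θ-possible-image set constant in `m`, typed (Ind1)/(Ind2) = Dupuy–Hilado families);
the per-label licence is a STRONGER-THAN-PRINT sufficient form of Step (xi-f) (ADJUDICATION-SPEC §2 (G1′)); nothing about the printed GLOBAL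
inequality, the NUMBER-level Corollary (`Cor22.Cor312AtDatum`) or any author's intended hull; admissibility / Szpiro-badness / (P6) of
`(ratPoint λ, l)` and non-emptiness of the datum type are NOT claimed (apex inputs); «refuted as typed» ≠ «refuted in print»; typed ≠ proved;
instantiated ≠ endorsed. [cite: Mochizuki2012, IUTchIII Cor. 3.12 Step (xi-f) p. 184; IUTchIV Prop. 1.2 (i)(ii) p. 10, Cor. 2.2 (ii) proof (P5) p. 46;
IUTchI Def. 3.1 (e) p. 62, Ex. 3.2 (iv) p. 67] [cite: DupuyHilado2025, §3.3, §3.4, §3.9, §4.9] [cite: NeukirchANT1999, Ch. II (5.5)]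
[cite: ScholzeStix2018, §2.2 pp. 9–10] [claim: Mochizuki2012, status: disputed] for every IUT sentence quoted.
-/

noncomputable section

open Set Function NumberField IsDedekindDomain

namespace Summit.ABC.IUTFork.Conditional

open Thm311 Thm311.Real Cor312 Cor312Vol Cor312Prov Literature.IUT.LogThetaLattice Literature.IUT.LogVolume
  Literature.IUT.HodgeTheaters Literature.IUT.LogVolume.ThetaData Literature.IUT.LogVolume.Cor22
open Literature.NumberTheory.NumberFields Literature.NumberTheory.GaloisRepresentations.Ultrametric
open Literature.NumberTheory.DiophantineGeometry Literature.NumberTheory.DiophantineGeometry.GenEll Summit.ABC.ABC.Theorems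

/-! ## §1. One lattice-tame member with `2l ≤ i₀·h` refutes S_H at the M-level setting -/

/-- **M LINE: ROBUST TAME-EXACT REFUTATION AT A RATIONAL POINT.** `λ ∈ ℚ`, `T` a genuine Θ-volume datum at `(ratPoint λ, l)`; `u` a finite place
of `ℚ` with `p = p_u ≠ 2, l` at which `j(λ)` has a pole of order `≥ h ≥ 1`; a label `j = i₀ + 1 ≤ l⋆ = (l−1)/2` with **`2l ≤ i₀·h`**; a member
`x₀ ∈ V̲_u` with `e(K_{x₀}/ℚ_p) ≤ p − 2` (lattice-tame — the LOCAL-TYPE input, a binder). THEN the hull-level clause S_H at the summand-route M-level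
sharp setting of `T`'s OWN read-off ideles (PINNED reading) FAILS for every choice of the free context binders and Kummer datum: `x₀` is bad
(`placeModOfM_mem_S_and_norm_tqM_le_of_ratPoint`), the read-off q-idele has an integer order `m_q` with `2l·m_q = e·(−ord_p j(λ)) ≥ e·h`
(abc-iut-w5-d166), so `e ≤ i₀·m_q` and abc-iut-w5-d107's floor-free lemma fires abc-iut-w5-d166's tame-member refutation of the licence.
Sharp reading; refuted-as-typed only. [cite: Mochizuki2012, IUTchIV Prop. 1.2 (i)(ii) p. 10, Cor. 2.2 (ii) proof (P5) p. 46; IUTchIII Cor. 3.12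
Step (xi-f) p. 184] [cite: DupuyHilado2025, §3.3, §3.4, §4.9] [claim: Mochizuki2012, status: disputed] -/
theorem GenuineM.not_pilotKummerCompatHull_ratPoint_of_tame_robust {q : ℚ} {l : ℕ}
    (T : Cor22.ThetaVolumeDatumAt (ratPoint q) l) (u : FinitePlace ℚ) (hp2 : ratChar u ≠ 2) (hpl : ratChar u ≠ l) (h : ℕ) (hh : 1 ≤ h)
    (hord : ∀ u' : HeightOneSpectrum (𝓞 ℚ), Rat.HeightOneSpectrum.natGenerator u' = ratChar u → ord ℚ u' (Cor22.jInv q) ≤ -(h : ℤ))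
    (i₀ : ℕ) (hil : i₀ + 1 ≤ (l - 1) / 2) (hi : 2 * l ≤ i₀ * h) :
    letI := T.instFieldF; letI := T.instNumberFieldF; letI := T.instAlgebraF; letI := T.instFieldK
    letI := T.instNumberFieldK; letI := T.instAlgebraK; letI := T.instFieldFbar; letI := T.instAlgebraFbar
    letI := T.instAlgebraKFbar; letI := T.instIsElliptic
    ∀ (x₀ : (thetaIndexOfInitial T.D).Fibre (Val.non u)),
      absRamificationIdx (ratChar u) (kOfM T.D (ratChar u) u (natCast_ratChar_mem u) x₀) ≤ ratChar u - 2 →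
    ∀ (M : Type) [Field M] [NumberField M]
      (archPk : ∀ (j : (thetaIndexOfInitial T.D).Label) (vQ : (thetaIndexOfInitial T.D).VQ),
        Set ((logShellsOfInitialDH T.D (analyticLogvVal T.K)).Packet j vQ))
      (archSub : ∀ (j : (thetaIndexOfInitial T.D).Label) (v : (thetaIndexOfInitial T.D).V),
        Set ((logShellsOfInitialDH T.D (analyticLogvVal T.K)).Packet j ((thetaIndexOfInitial T.D).over v)))
      (Ψ : ℤ → ∀ v : (thetaIndexOfInitial T.D).V, v ∈ (thetaIndexOfInitial T.D).Vbad →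
        Set ((logShellsOfInitialDH T.D (analyticLogvVal T.K)).StarPacket v))
      (act : ℤ → ∀ v : (thetaIndexOfInitial T.D).V, v ∈ (thetaIndexOfInitial T.D).Vbad →
        (logShellsOfInitialDH T.D (analyticLogvVal T.K)).StarPacket v →
          Module.End ℚ ((logShellsOfInitialDH T.D (analyticLogvVal T.K)).StarPacket v))
      (Mmod : ℤ → ∀ j : (thetaIndexOfInitial T.D).LabelStar, Set ((logShellsOfInitialDH T.D (analyticLogvVal T.K)).GlobalPacket j.1))
      (region : ℤ → ∀ j : (thetaIndexOfInitial T.D).LabelStar, FinDivisor M → ∀ vQ : (thetaIndexOfInitial T.D).VQ,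
        Set ((logShellsOfInitialDH T.D (analyticLogvVal T.K)).Packet j.1 vQ))
      (frobAdm : ℤ → ℤ → ∀ (j : (thetaIndexOfInitial T.D).Label) (vQ : (thetaIndexOfInitial T.D).VQ),
        Set ((logShellsOfInitialDH T.D (analyticLogvVal T.K)).Packet j vQ) → Prop)
      (frobLogvol : ℤ → ℤ → ∀ (j : (thetaIndexOfInitial T.D).Label) (vQ : (thetaIndexOfInitial T.D).VQ),
        Set ((logShellsOfInitialDH T.D (analyticLogvVal T.K)).Packet j vQ) → ℝ)
      (frobΨ : ℤ → ℤ → ∀ v : (thetaIndexOfInitial T.D).V, v ∈ (thetaIndexOfInitial T.D).Vbad →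
        Set ((logShellsOfInitialDH T.D (analyticLogvVal T.K)).StarPacket v))
      (frobMmod : ℤ → ℤ → ∀ j : (thetaIndexOfInitial T.D).LabelStar, Set ((logShellsOfInitialDH T.D (analyticLogvVal T.K)).GlobalPacket j.1))
      (unitImage : ℤ → ℤ → ℕ → ∀ (j : (thetaIndexOfInitial T.D).Label) (vQ : (thetaIndexOfInitial T.D).VQ),
        Set ((logShellsOfInitialDH T.D (analyticLogvVal T.K)).Packet j vQ))
      (ballImage : ℤ → ℤ → ∀ (j : (thetaIndexOfInitial T.D).Label) (vQ : (thetaIndexOfInitial T.D).VQ),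
        Set ((logShellsOfInitialDH T.D (analyticLogvVal T.K)).Packet j vQ))
      (thetaDiv : ℤ → ℤ → LgpDivisor M (thetaIndexOfInitial T.D).lstar)
      (n : ℤ) {HT : Type} {LogLink : HT → HT → Type} {IsFull : ∀ {s t : HT}, LogLink s t → Prop}
      (lat : LGPGaussianLogThetaLattice LogLink IsFull)
      {Frd : Type} {IsoF : Frd → Frd → Type} {Ob : Frd → Type} {realify : Frd → Frd} {Strip : Type}
      {IsoS : Strip → Strip → Type} {Mv : ∀ v : (thetaIndexOfInitial T.D).V, v ∈ (thetaIndexOfInitial T.D).Vbad → Type}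
      [∀ v h, Monoid (Mv v h)]
      (sig : GlobalLGPFrobenioidSignature (thetaIndexOfInitial T.D).lstar (thetaIndexOfInitial T.D).V
        (· ∈ (thetaIndexOfInitial T.D).Vbad) Frd IsoF Ob realify Strip IsoS Mv)
      (split : SplittingMonoids Mv) {ObΔ : Type} {N : ∀ v : (thetaIndexOfInitial T.D).V, v ∈ (thetaIndexOfInitial T.D).Vbad → Type}
      [∀ v h, Monoid (N v h)] (qData : QPilotData ObΔ N)
      (qK : ∀ v : (thetaIndexOfInitial T.D).V, v ∈ (thetaIndexOfInitial T.D).Vbad →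
        Set ((logShellsOfInitialDH T.D (analyticLogvVal T.K)).StarPacket v)),
      ¬ Cor312Vol.PilotKummerCompatHull
        (LatticeSituation.ofShells (logShellsOfInitialDH T.D (analyticLogvVal T.K)) M archPk archSub
          (summandPiecesPrM T.D (logvAnalyticVal_analyticLogvVal (K := T.K))).Adm (summandPiecesPrM T.D (logvAnalyticVal_analyticLogvVal (K := T.K))).logvol Ψ act Mmod region frobAdm frobLogvol
          frobΨ frobMmod unitImage ballImage thetaDiv)
        (settingPrVolSharpM T.D (logvAnalyticVal_analyticLogvVal (K := T.K)) (tOfIdeleData T.D (ideleDataOf T.D T.isVolumeInputOf))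
          (fun u x => tqM T.D (ratChar u) u (natCast_ratChar_mem u) (ideleDataOf T.D T.isVolumeInputOf) x) M archPk archSub Ψ act Mmod region n lat sig split qData
          (fun u x => tqM_ne_zero T.D (ratChar u) u (natCast_ratChar_mem u) (ideleDataOf T.D T.isVolumeInputOf) x)
          (GenuineM.finite_ratPlaces_under_S T.D).toFinset
          (fun u x hu => norm_tqM_eq_one_of_not_mem T.D (ratChar u) u (natCast_ratChar_mem u) (ideleDataOf T.D T.isVolumeInputOf) x
            fun hx => hu ((Set.Finite.mem_toFinset _).mpr ⟨x, hx⟩)))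
        (fun _ => Cor312.Setting.qRegion
          (settingPrVolSharpM T.D (logvAnalyticVal_analyticLogvVal (K := T.K)) (tOfIdeleData T.D (ideleDataOf T.D T.isVolumeInputOf))
          (fun u x => tqM T.D (ratChar u) u (natCast_ratChar_mem u) (ideleDataOf T.D T.isVolumeInputOf) x) M archPk archSub Ψ act Mmod region n lat sig split qData
          (fun u x => tqM_ne_zero T.D (ratChar u) u (natCast_ratChar_mem u) (ideleDataOf T.D T.isVolumeInputOf) x)
          (GenuineM.finite_ratPlaces_under_S T.D).toFinset
          (fun u x hu => norm_tqM_eq_one_of_not_mem T.D (ratChar u) u (natCast_ratChar_mem u) (ideleDataOf T.D T.isVolumeInputOf) x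
            fun hx => hu ((Set.Finite.mem_toFinset _).mpr ⟨x, hx⟩)))) qK := by
  classical
  letI := T.instFieldF; letI := T.instNumberFieldF; letI := T.instAlgebraF; letI := T.instFieldK
  letI := T.instNumberFieldK; letI := T.instAlgebraK; letI := T.instFieldFbar; letI := T.instAlgebraFbar
  letI := T.instAlgebraKFbar; letI := T.instIsElliptic
  intro x₀ hx₀ M _ _ archPk archSub Ψ act Mmod region frobAdm frobLogvol frobΨ frobMmod unitImage ballImage thetaDiv n HT LogLink IsFull lat
    Frd IsoF Ob realify Strip IsoS Mv _ sig split ObΔ N _ qData qK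
  set p : ℕ := ratChar u with hpdef
  haveI hpfact : Fact p.Prime := inferInstance
  have hlstar : (thetaIndexOfInitial T.D).lstar = (l - 1) / 2 := rfl
  have hlt : i₀ < (thetaIndexOfInitial T.D).lstar := by rw [hlstar]; omega
  have hl5 : 5 ≤ l := T.D.five_le_l
  have hp2' : 2 < p := by
    have := hpfact.out.two_le
    omega
  -- the member `x₀` is bad (every member over a pole prime `≠ 2, l` is)
  obtain ⟨hS, -⟩ := placeModOfM_mem_S_and_norm_tqM_le_of_ratPoint T.D p u (natCast_ratChar_mem u)
    (ideleDataOf T.D T.isVolumeInputOf) q T.j_eq T.isP5Choice x₀ hp2 hpl h hh hord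
  -- a norm uniformiser of `K_{x₀}` (the rescaled completion of `T.K` at `placeOfM x₀`) and the integer order `m_q` of the read-off q-idele
  obtain ⟨ϖ, hϖ, -⟩ := exists_isUniformizer_rescaledCompletion T.K p (placeOfM T.D u x₀) (natCast_mem_placeOfM T.D p u (natCast_ratChar_mem u) x₀)
  obtain ⟨mq, hmq⟩ := exists_int_norm_tqM_eq_zpow T.D p u (natCast_ratChar_mem u) (ideleDataOf T.D T.isVolumeInputOf) x₀ hϖ
  -- its value at rational `j`: `2l·m_q = −e·ord_p j(λ)`
  have hjF : T.E.j = ((Cor22.jInv q : ℚ) : T.F) := by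
    rw [T.j_eq]
    exact eq_ratCast _ _
  have hval := two_mul_l_mul_order_tqM_eq_of_j_eq T.D p u (natCast_ratChar_mem u) (ideleDataOf T.D T.isVolumeInputOf) x₀ hS
    (Cor22.jInv q) hjF hϖ hmq
  have hordp := hord _ (natGenerator_finBelow_placeModOfM T.D p u (natCast_ratChar_mem u) x₀)
  set e : ℕ := absRamificationIdx p (kOfM T.D p u (natCast_ratChar_mem u) x₀) with hedef
  have he0 : 0 < e := absRamificationIdx_pos p _
  -- `e ≤ i₀·m_q`: `2l·e ≤ i₀·h·e ≤ i₀·(2l·m_q)` — the local type cancels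
  have hle : (e : ℤ) ≤ (i₀ : ℤ) * mq := by
    have heZ : (0 : ℤ) < (e : ℤ) := by exact_mod_cast he0
    have hl0 : (0 : ℤ) < 2 * (l : ℤ) := by
      have : (0 : ℤ) < (l : ℤ) := by exact_mod_cast (show 0 < l by omega)
      linarith
    have h1 : (e : ℤ) * (h : ℤ) ≤ (2 * l : ℤ) * mq := by
      rw [hval]
      nlinarith [hordp, heZ]
    have h2 : (2 * l : ℤ) * (e : ℤ) ≤ ((i₀ : ℤ) * (h : ℤ)) * (e : ℤ) := by
      have hiZ : (2 * l : ℤ) ≤ (i₀ : ℤ) * (h : ℤ) := by exact_mod_cast hi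
      exact mul_le_mul_of_nonneg_right hiZ heZ.le
    have h3 : (2 * l : ℤ) * (e : ℤ) ≤ (2 * l : ℤ) * ((i₀ : ℤ) * mq) := by
      have hi0 : (0 : ℤ) ≤ (i₀ : ℤ) := by positivity
      nlinarith [h1, h2, hi0]
    exact le_of_mul_le_mul_left h3 hl0
  -- abc-iut-w5-d107's floor-free lemma ⇒ abc-iut-w5-d166's integer test at `(u, i₀, x₀)`
  have htest := TameRobust.lt_decider_of_le (e := (e : ℤ)) (i₀ := (i₀ : ℤ)) (P := mq) (by exact_mod_cast he0) (by positivity) hle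
  have htest' : mq < (e : ℤ) * ((mq * ((((i₀ : ℕ) + 1) ^ 2 : ℕ) : ℤ) - 1) / (e : ℤ)) + 1 - ((i₀ : ℤ) + 1) * ((e : ℤ) - 1) := by
    have hc : mq * ((((i₀ : ℕ) + 1) ^ 2 : ℕ) : ℤ) = ((i₀ : ℤ) + 1) ^ 2 * mq := by
      push_cast
      ring
    rw [hc]
    exact htest
  -- the q-pin holds by `rfl`, so S_H is the licence, which the tame member refutes
  intro hSH
  exact not_licence_settingPrVolSharpM_tOfIdeleData_of_tame_orders T.D (logvAnalyticVal_analyticLogvVal (K := T.K))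
    (ideleDataOf T.D T.isVolumeInputOf) M archPk archSub Ψ act Mmod region n lat sig split qData
    (fun u x => tqM_ne_zero T.D (ratChar u) u (natCast_ratChar_mem u) (ideleDataOf T.D T.isVolumeInputOf) x)
    (GenuineM.finite_ratPlaces_under_S T.D).toFinset
    (fun u x hu => norm_tqM_eq_one_of_not_mem T.D (ratChar u) u (natCast_ratChar_mem u) (ideleDataOf T.D T.isVolumeInputOf) x
      fun hx => hu ((Set.Finite.mem_toFinset _).mpr ⟨x, hx⟩))
    u ⟨i₀, hlt⟩ x₀ hp2' hx₀ hϖ hmq htest'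
    (licence_of_pilotKummerCompatHull
      (LatticeSituation.ofShells (logShellsOfInitialDH T.D (analyticLogvVal T.K)) M archPk archSub
        (summandPiecesPrM T.D (logvAnalyticVal_analyticLogvVal (K := T.K))).Adm
        (summandPiecesPrM T.D (logvAnalyticVal_analyticLogvVal (K := T.K))).logvol Ψ act Mmod region frobAdm frobLogvol
        frobΨ frobMmod unitImage ballImage thetaDiv)
      _ _ qK (fun _ _ => rfl) hSH)

/-! ## §2. The binder in PLACE form: every place of `T.K` over `p_u` lattice-tame -/

/-- **M LINE, per-datum refutation from a PLACE-form local type.** `λ ∈ ℚ`, `T` a genuine Θ-volume datum at `(ratPoint λ, l)`, `u` a finite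
place of `ℚ` with `p = p_u ≠ 2, l` at which `j(λ)` has a pole of order `≥ h ≥ 1`, a label `j = i₀+1 ≤ l⋆` with **`2l ≤ i₀·h`**, and the LOCAL-TYPE
input in place form: every place `w` of `T.K` of residue characteristic `p` has `e(w | p) ≤ p − 2`. THEN S_H at the M-level sharp setting of `T`'s
own ideles (pinned reading) FAILS for every choice of the free context binders and Kummer datum (§1 at any member `x₀ ∈ V̲_u` — the fibre is
non-empty — whose norm-defined `e(K_{x₀}/ℚ_p)` IS `e(placeOfM x₀ | p)`, `absRamificationIdx_rescaledCompletion`). M twin of abc-iut-W-ref-2's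
`GenuineK.not_pilotKummerCompatHull_chosen_ratPoint_of_localType`. [cite: Mochizuki2012, IUTchIV Cor. 2.2 (ii) proof (P5) p. 46; IUTchIII Cor. 3.12
Step (xi-f) p. 184] [claim: Mochizuki2012, status: disputed] -/
theorem GenuineM.not_pilotKummerCompatHull_ratPoint_of_localType {q : ℚ} {l : ℕ}
    (T : Cor22.ThetaVolumeDatumAt (ratPoint q) l) (u : FinitePlace ℚ) (hp2 : ratChar u ≠ 2) (hpl : ratChar u ≠ l)
    (hloc : letI := T.instFieldK; letI := T.instNumberFieldK
      ∀ w : HeightOneSpectrum (𝓞 T.K), residueChar T.K w = ratChar u → w.asIdeal.ramificationIdx ℤ ≤ ratChar u - 2)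
    (h : ℕ) (hh : 1 ≤ h)
    (hord : ∀ u' : HeightOneSpectrum (𝓞 ℚ), Rat.HeightOneSpectrum.natGenerator u' = ratChar u → ord ℚ u' (Cor22.jInv q) ≤ -(h : ℤ))
    (i₀ : ℕ) (hil : i₀ + 1 ≤ (l - 1) / 2) (hi : 2 * l ≤ i₀ * h) :
    letI := T.instFieldF; letI := T.instNumberFieldF; letI := T.instAlgebraF; letI := T.instFieldK
    letI := T.instNumberFieldK; letI := T.instAlgebraK; letI := T.instFieldFbar; letI := T.instAlgebraFbar
    letI := T.instAlgebraKFbar; letI := T.instIsElliptic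
    ∀ (M : Type) [Field M] [NumberField M]
      (archPk : ∀ (j : (thetaIndexOfInitial T.D).Label) (vQ : (thetaIndexOfInitial T.D).VQ),
        Set ((logShellsOfInitialDH T.D (analyticLogvVal T.K)).Packet j vQ))
      (archSub : ∀ (j : (thetaIndexOfInitial T.D).Label) (v : (thetaIndexOfInitial T.D).V),
        Set ((logShellsOfInitialDH T.D (analyticLogvVal T.K)).Packet j ((thetaIndexOfInitial T.D).over v)))
      (Ψ : ℤ → ∀ v : (thetaIndexOfInitial T.D).V, v ∈ (thetaIndexOfInitial T.D).Vbad →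
        Set ((logShellsOfInitialDH T.D (analyticLogvVal T.K)).StarPacket v))
      (act : ℤ → ∀ v : (thetaIndexOfInitial T.D).V, v ∈ (thetaIndexOfInitial T.D).Vbad →
        (logShellsOfInitialDH T.D (analyticLogvVal T.K)).StarPacket v →
          Module.End ℚ ((logShellsOfInitialDH T.D (analyticLogvVal T.K)).StarPacket v))
      (Mmod : ℤ → ∀ j : (thetaIndexOfInitial T.D).LabelStar, Set ((logShellsOfInitialDH T.D (analyticLogvVal T.K)).GlobalPacket j.1))
      (region : ℤ → ∀ j : (thetaIndexOfInitial T.D).LabelStar, FinDivisor M → ∀ vQ : (thetaIndexOfInitial T.D).VQ,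
        Set ((logShellsOfInitialDH T.D (analyticLogvVal T.K)).Packet j.1 vQ))
      (frobAdm : ℤ → ℤ → ∀ (j : (thetaIndexOfInitial T.D).Label) (vQ : (thetaIndexOfInitial T.D).VQ),
        Set ((logShellsOfInitialDH T.D (analyticLogvVal T.K)).Packet j vQ) → Prop)
      (frobLogvol : ℤ → ℤ → ∀ (j : (thetaIndexOfInitial T.D).Label) (vQ : (thetaIndexOfInitial T.D).VQ),
        Set ((logShellsOfInitialDH T.D (analyticLogvVal T.K)).Packet j vQ) → ℝ)
      (frobΨ : ℤ → ℤ → ∀ v : (thetaIndexOfInitial T.D).V, v ∈ (thetaIndexOfInitial T.D).Vbad →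
        Set ((logShellsOfInitialDH T.D (analyticLogvVal T.K)).StarPacket v))
      (frobMmod : ℤ → ℤ → ∀ j : (thetaIndexOfInitial T.D).LabelStar, Set ((logShellsOfInitialDH T.D (analyticLogvVal T.K)).GlobalPacket j.1))
      (unitImage : ℤ → ℤ → ℕ → ∀ (j : (thetaIndexOfInitial T.D).Label) (vQ : (thetaIndexOfInitial T.D).VQ),
        Set ((logShellsOfInitialDH T.D (analyticLogvVal T.K)).Packet j vQ))
      (ballImage : ℤ → ℤ → ∀ (j : (thetaIndexOfInitial T.D).Label) (vQ : (thetaIndexOfInitial T.D).VQ),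
        Set ((logShellsOfInitialDH T.D (analyticLogvVal T.K)).Packet j vQ))
      (thetaDiv : ℤ → ℤ → LgpDivisor M (thetaIndexOfInitial T.D).lstar)
      (n : ℤ) {HT : Type} {LogLink : HT → HT → Type} {IsFull : ∀ {s t : HT}, LogLink s t → Prop}
      (lat : LGPGaussianLogThetaLattice LogLink IsFull)
      {Frd : Type} {IsoF : Frd → Frd → Type} {Ob : Frd → Type} {realify : Frd → Frd} {Strip : Type}
      {IsoS : Strip → Strip → Type} {Mv : ∀ v : (thetaIndexOfInitial T.D).V, v ∈ (thetaIndexOfInitial T.D).Vbad → Type}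
      [∀ v h, Monoid (Mv v h)]
      (sig : GlobalLGPFrobenioidSignature (thetaIndexOfInitial T.D).lstar (thetaIndexOfInitial T.D).V
        (· ∈ (thetaIndexOfInitial T.D).Vbad) Frd IsoF Ob realify Strip IsoS Mv)
      (split : SplittingMonoids Mv) {ObΔ : Type} {N : ∀ v : (thetaIndexOfInitial T.D).V, v ∈ (thetaIndexOfInitial T.D).Vbad → Type}
      [∀ v h, Monoid (N v h)] (qData : QPilotData ObΔ N)
      (qK : ∀ v : (thetaIndexOfInitial T.D).V, v ∈ (thetaIndexOfInitial T.D).Vbad →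
        Set ((logShellsOfInitialDH T.D (analyticLogvVal T.K)).StarPacket v)),
      ¬ Cor312Vol.PilotKummerCompatHull
        (LatticeSituation.ofShells (logShellsOfInitialDH T.D (analyticLogvVal T.K)) M archPk archSub
          (summandPiecesPrM T.D (logvAnalyticVal_analyticLogvVal (K := T.K))).Adm (summandPiecesPrM T.D (logvAnalyticVal_analyticLogvVal (K := T.K))).logvol Ψ act Mmod region frobAdm frobLogvol
          frobΨ frobMmod unitImage ballImage thetaDiv)
        (settingPrVolSharpM T.D (logvAnalyticVal_analyticLogvVal (K := T.K)) (tOfIdeleData T.D (ideleDataOf T.D T.isVolumeInputOf))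
          (fun u x => tqM T.D (ratChar u) u (natCast_ratChar_mem u) (ideleDataOf T.D T.isVolumeInputOf) x) M archPk archSub Ψ act Mmod region n lat sig split qData
          (fun u x => tqM_ne_zero T.D (ratChar u) u (natCast_ratChar_mem u) (ideleDataOf T.D T.isVolumeInputOf) x)
          (GenuineM.finite_ratPlaces_under_S T.D).toFinset
          (fun u x hu => norm_tqM_eq_one_of_not_mem T.D (ratChar u) u (natCast_ratChar_mem u) (ideleDataOf T.D T.isVolumeInputOf) x
            fun hx => hu ((Set.Finite.mem_toFinset _).mpr ⟨x, hx⟩)))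
        (fun _ => Cor312.Setting.qRegion
          (settingPrVolSharpM T.D (logvAnalyticVal_analyticLogvVal (K := T.K)) (tOfIdeleData T.D (ideleDataOf T.D T.isVolumeInputOf))
          (fun u x => tqM T.D (ratChar u) u (natCast_ratChar_mem u) (ideleDataOf T.D T.isVolumeInputOf) x) M archPk archSub Ψ act Mmod region n lat sig split qData
          (fun u x => tqM_ne_zero T.D (ratChar u) u (natCast_ratChar_mem u) (ideleDataOf T.D T.isVolumeInputOf) x)
          (GenuineM.finite_ratPlaces_under_S T.D).toFinset
          (fun u x hu => norm_tqM_eq_one_of_not_mem T.D (ratChar u) u (natCast_ratChar_mem u) (ideleDataOf T.D T.isVolumeInputOf) x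
            fun hx => hu ((Set.Finite.mem_toFinset _).mpr ⟨x, hx⟩)))) qK := by
  classical
  letI := T.instFieldF; letI := T.instNumberFieldF; letI := T.instAlgebraF; letI := T.instFieldK
  letI := T.instNumberFieldK; letI := T.instAlgebraK; letI := T.instFieldFbar; letI := T.instAlgebraFbar
  letI := T.instAlgebraKFbar; letI := T.instIsElliptic
  intro M _ _ archPk archSub Ψ act Mmod region frobAdm frobLogvol frobΨ frobMmod unitImage ballImage thetaDiv n HT LogLink IsFull lat
    Frd IsoF Ob realify Strip IsoS Mv _ sig split ObΔ N _ qData qK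
  set p : ℕ := ratChar u with hpdef
  haveI hpfact : Fact p.Prime := inferInstance
  obtain ⟨v, hv⟩ := (thetaIndexOfInitial T.D).fibre_nonempty (Val.non u)
  set w := placeOfM T.D u ⟨v, hv⟩ with hwdef
  have hpw : ((p : ℕ) : 𝓞 T.K) ∈ w.asIdeal := natCast_mem_placeOfM T.D p u (natCast_ratChar_mem u) ⟨v, hv⟩
  have hwchar : residueChar T.K w = p := residueChar_eq_of_natCast_mem p hpw
  have hx₀ : absRamificationIdx p (kOfM T.D p u (natCast_ratChar_mem u) ⟨v, hv⟩) ≤ p - 2 := by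
    rw [show absRamificationIdx p (kOfM T.D p u (natCast_ratChar_mem u) ⟨v, hv⟩) = w.asIdeal.ramificationIdx ℤ from
      absRamificationIdx_rescaledCompletion T.K p w hpw]
    exact hloc w hwchar
  exact GenuineM.not_pilotKummerCompatHull_ratPoint_of_tame_robust T u hp2 hpl h hh hord i₀ hil hi ⟨v, hv⟩ hx₀ M archPk archSub
    Ψ act Mmod region frobAdm frobLogvol frobΨ frobMmod unitImage ballImage thetaDiv n lat sig split qData qK

end Summit.ABC.IUTFork.Conditional

end
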